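import Mathlib
import Summits.Ventures.PercRepro.PuncturedLYMUnif55Table
import Summits.Ventures.PercRepro.PuncturedLYMUnif55Rows1

/-!
# PercRepro — (SP) FOR ANY NUMBER OF PAIRWISE DISJOINT `5`-SETS AT LEVEL `5`: THE ROW IDENTITIES, ASSEMBLED
(p10, gen 41)

`row_check`: the row identity of every class with `Σ v c_v ≤ 5`, by nested `interval_cases` over the class counts (only the feasible classes are enumerated).  Nothing here asserts (SP).
-/

namespace PercRepro.PuncturedLYM.Split.TypeLift.Unif55

/-- The row identity of every class, in one statement. -/
theorem row_check (n k : ℚ) (hQ : Qp n k ≠ 0) (hP : Pp n k ≠ 0) (hPc : Pc n k ≠ 0) (c1 c2 c3 c4 : ℕ)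
    (h : c1 + 2 * c2 + 3 * c3 + 4 * c4 ≤ 5) :
    5 * (k - ((c1 : ℚ) + c2 + c3 + c4)) * raw n k c1 c2 c3 c4 0 + 4 * (c1 : ℚ) * raw n k c1 c2 c3 c4 1 + 3 * (c2 : ℚ) * raw n k c1 c2 c3 c4 2 + 2 * (c3 : ℚ) * raw n k c1 c2 c3 c4 3 + (c4 : ℚ) / 5 +
      (n - 5 * k - ((5 : ℚ) - c1 - 2 * c2 - 3 * c3 - 4 * c4)) * raw n k c1 c2 c3 c4 5 = Yc n / Pc n k := by
  have hb4 : c4 ≤ 1 := by omega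
  interval_cases c4
  · have hb3 : c3 ≤ 1 := by omega
    interval_cases c3
    · have hb2 : c2 ≤ 2 := by omega
      interval_cases c2
      · have hb1 : c1 ≤ 5 := by omega
        interval_cases c1
        · push_cast
          linear_combination row_0000 n k hQ hP hPc
        · push_cast
          linear_combination row_1000 n k hQ hP hPc
        · push_cast
          linear_combination row_2000 n k hQ hP hPc
        · push_cast
          linear_combination row_3000 n k hQ hP hPc
        · push_cast
          linear_combination row_4000 n k hQ hP hPc
        · push_cast
          linear_combination row_5000 n k hQ hP hPc
      · have hb1 : c1 ≤ 3 := by omega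
        interval_cases c1
        · push_cast
          linear_combination row_0100 n k hQ hP hPc
        · push_cast
          linear_combination row_1100 n k hQ hP hPc
        · push_cast
          linear_combination row_2100 n k hQ hP hPc
        · push_cast
          linear_combination row_3100 n k hQ hP hPc
      · have hb1 : c1 ≤ 1 := by omega
        interval_cases c1
        · push_cast
          linear_combination row_0200 n k hQ hP hPc
        · push_cast
          linear_combination row_1200 n k hQ hP hPc
    · have hb2 : c2 ≤ 1 := by omega
      interval_cases c2
      · have hb1 : c1 ≤ 2 := by omega
        interval_cases c1
        · push_cast
          linear_combination row_0010 n k hQ hP hPc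
        · push_cast
          linear_combination row_1010 n k hQ hP hPc
        · push_cast
          linear_combination row_2010 n k hQ hP hPc
      · have hb1 : c1 ≤ 0 := by omega
        interval_cases c1
        · push_cast
          linear_combination row_0110 n k hQ hP hPc
  · have hb3 : c3 ≤ 0 := by omega
    interval_cases c3
    · have hb2 : c2 ≤ 0 := by omega
      interval_cases c2
      · have hb1 : c1 ≤ 1 := by omega
        interval_cases c1
        · push_cast
          linear_combination row_0001 n k hQ hP hPc
        · push_cast
          linear_combination row_1001 n k hQ hP hPc

end PercRepro.PuncturedLYM.Split.TypeLift.Unif55
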